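import Summits.AtomisticToContinuum.Crystallization.Theorems.FreeSplittingCertificatesStrictSplittingRuleTorusModel442A
import Summits.AtomisticToContinuum.Crystallization.Theorems.FreeSplittingCertificatesStrictSplittingRuleTorusModel442B

/-!
# Torus model 4×4×2: coordinate relabelling by translations and the covariance CHECK for parity A

Route `FreeSplittingCertificates`, crux `StrictSplittingRule` (stmt-AtomisticToContinuum-12560); unit b2b-freesplit-B (block 2b,
PART B, gen 1).  **VALUE = theorem about a FINITE model — NOT summit progress**; `stub_coreJointCoercive` is not proved.

`…TorusModel442A/B.lean` prove the torus LMI at the two reference sites `siteA = (0,0,0)`, `siteB = (1,0,0)`.  Every site of the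
torus is an even-layer translate of one of them and the model is translation covariant; here this is CHECKED, not asserted:
`native_decide` verifies that for every even-layer shift `g` the term lists (supply, transfers, κ-demand, readout form) generated
at the shifted site are EXACTLY the reference lists with coordinates relabelled by the translation (`covA_check`, `covB_check`), that
the shifts cover all 64 sites (`cover_check`), and that the norm / mean terms are permuted (`norm_perm_check`, `sumF_perm_check`);
generic lemmas (`evalQ_mapShift`, `evalQ_perm`) then transport `jointLMI442A/B` to every site (file `…TorusModel442AllSites.lean`:
`jointLMI442_allSites`).  This file: the relabelling machinery and `covA_check` (32 shifts; ~3 min in the evaluator); `covB_check` is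
in `…TorusModel442CovB.lean`.  COMPUTATIONAL regime (`native_decide`, `Lean.ofReduceBool`). [folklore]
-/

namespace Summit.AtomisticToContinuum.Crystallization.Theorems.StrictSplittingRuleTorusLMI

open Literature.Computation.Certificates

/-! ## Coordinate relabelling by a torus translation -/

/-- The site of a coordinate index (`idx (k,i,j) c = 3(16k+4i+j)+c`). [folklore] -/
def siteOf (n : Fin 192) : Site := (⟨n.val / 48, by omega⟩, ⟨n.val / 12 % 4, by omega⟩, ⟨n.val / 3 % 4, by omega⟩)

/-- The component of a coordinate index. [folklore] -/
def compOf (n : Fin 192) : Fin 3 := ⟨n.val % 3, by omega⟩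

/-- Relabelling of coordinates induced by the translation `q ↦ q + g`. [folklore] -/
def shiftIdx (g : Off) (n : Fin 192) : Fin 192 := idx (tadd (siteOf n) g) (compOf n)

/-- Relabel a functional. [folklore] -/
def LinF.relabel (σ : Fin 192 → Fin 192) (ℓ : LinF 192) : LinF 192 := ℓ.map fun p => (σ p.1, p.2)

/-- Relabel a term. [folklore] -/
def shiftTerm (σ : Fin 192 → Fin 192) (t : Term 192) : Term 192 := (t.1, LinF.relabel σ t.2.1, LinF.relabel σ t.2.2)

/-- A relabelled functional at `u` is the functional at `u ∘ σ`. [folklore] -/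
theorem LinF.eval_relabel (σ : Fin 192 → Fin 192) (ℓ : LinF 192) (u : Fin 192 → ℚ) :
    LinF.eval (LinF.relabel σ ℓ) u = LinF.eval ℓ (u ∘ σ) := by
  induction ℓ with
  | nil => simp [LinF.relabel]
  | cons p t ih => simp only [LinF.relabel, List.map_cons, LinF.eval_cons] at ih ⊢; rw [ih]; rfl

/-- Relabelled term lists at `u` are the original lists at `u ∘ σ`. [folklore] -/
theorem evalQ_mapShift (σ : Fin 192 → Fin 192) (ts : List (Term 192)) (u : Fin 192 → ℚ) :
    evalQ (ts.map (shiftTerm σ)) u = evalQ ts (u ∘ σ) := by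
  induction ts with
  | nil => simp
  | cons t ts ih => simp only [List.map_cons, evalQ_cons, shiftTerm, LinF.eval_relabel] at ih ⊢; rw [ih]

/-- `evalQ` is invariant under permutation of the term list. [folklore] -/
theorem evalQ_perm {ts ts' : List (Term 192)} (h : ts.Perm ts') (u : Fin 192 → ℚ) : evalQ ts u = evalQ ts' u := by
  unfold evalQ; exact (h.map _).sum_eq

/-- `LinF.eval` is invariant under permutation of the entries. [folklore] -/
theorem LinF.eval_perm {ℓ ℓ' : LinF 192} (h : ℓ.Perm ℓ') (u : Fin 192 → ℚ) : LinF.eval ℓ u = LinF.eval ℓ' u := by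
  unfold LinF.eval; exact (h.map _).sum_eq

/-! ## The finite checks (computational) -/

/-- Even-layer shifts (they preserve parity): `dk ∈ {0, 2}`, `di, dj ∈ {0,…,3}`. [folklore] -/
def evenShifts : List Off :=
  [(0 : ℤ), 2].flatMap fun dk => (irange 0 3).flatMap fun di => (irange 0 3).map fun dj => (dk, di, dj)

/-- The site-dependent term lists, as a 4-tuple packed into one list of lists (supply, transfers, κ, readout). [folklore] -/
def siteTermLists (p : Site) : List (List (Term 192)) :=
  [supplyTerms p (thetaList p), transferTerms p tableClasses, kappaTerms p (thetaList p), readoutTerms p (thetaList p) betaTable]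

/-- **Covariance check, parity A**: at every even-layer translate of `siteA` the generated term lists are the reference lists
with coordinates relabelled by the translation.  COMPUTATIONAL (`native_decide`). -/
theorem covA_check : ∀ g ∈ evenShifts,
    siteTermLists (tadd siteA g) = (siteTermLists siteA).map fun ts => ts.map (shiftTerm (shiftIdx g)) := by
  native_decide

end Summit.AtomisticToContinuum.Crystallization.Theorems.StrictSplittingRuleTorusLMI
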